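import Literature.AlgebraicGeometry.Motives.PlaceReduction
import Literature.AlgebraicGeometry.Motives.GaloisDescentFieldPoints
import Literature.AlgebraicGeometry.Motives.AbelianVarietyRationalFunctionFieldPoints
import Literature.NumberTheory.DiophantineGeometry.FunctionFieldGaloisFibreCount
import Literature.NumberTheory.DiophantineGeometry.FunctionFieldDivisorsNegativeDegreeProofs
import Literature.NumberTheory.DiophantineGeometry.FunctionFieldConstantExtensionGenusProofs
import Literature.AlgebraicGeometry.Motives.CurveRiemannRoch
import HarnessLib

/-!
# Abel's theorem, I: the symmetric function of the conjugates of a point is constant, specialises,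
# and sums to zero over the places of `Ω(h)` (Lang, *Abelian Varieties*, II §2, proof of Thm. 10)

S. Lang, *Abelian Varieties* (1959/1983), II §2 Thm. 10 (Abel's theorem for a morphism `f : C → A`
of a complete non-singular curve into an abelian variety: `Σ_P ord_P(h) f(P) = 0` for every
`h ∈ K(C)^×`). Lang's proof: for the generic point `u` of the line given by `h`, the conjugates
`Q_τ` of a point of `C` over `u` (one for each `K(u)`-embedding `τ : K(C) → M` into a normal
closure `M`) give the point `T(u) = Σ_τ f(Q_τ)` of `A`, which «is rational over `K(u)` … it is
constant» (Galois descent, then `A(K(u)) = A(K)` because `K(u)` is a rational function field), and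
the specialisations of `u` («`x'_i → x_i` be a specialization … `T(u) → T(z)`») recover the zeros
and poles of `h` with multiplicity. This file assembles that proof from the tree's ingredients,
model-free, for an arbitrary tower of fields `Ω ⊆ F₀ ⊆ L = K(C) ⊆ M` (`Ω` algebraically closed,
`M/F₀` finite Galois, `F₀ ≅ Frac Ω[X]`), any abelian variety `A/Ω` and any `f : C ⟶ A.X`; the
sequel `Motives/AbelTheorem` instantiates `F₀ := Ω(h)`, `M :=` a normal closure, and reads the
result on `Ω`-points (`Jacobian.ajSum_principal`).

* `PlaceReduction.liftOver_comp`, `red_comp`, `red_map` — reduction at a rational place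
  (`Motives/PlaceReduction`) is natural in the proper scheme; `PlaceReduction.smul_embPt` — `Gal`
  permutes the points `Spec M → Spec K(C) → C` of the embeddings (`σ • embPt τ = embPt (σ ∘ τ)`);
* `AbelianVariety.smul_prod_map_embPt`, `exists_prod_map_embPt_eq_const` — the product
  `T = ∏_τ f(embPt τ)` over the `F₀`-embeddings `τ : L → M` is `Gal(M/F₀)`-invariant, hence
  (`AlgPoints.exists_eq_specOverMapOfAlgHom_of_forall_smul_eq`, Görtz–Wedhorn I Thm. 14.72 (1);
  `AbelianVariety.algPoints_const_of_algEquiv`, Milne AV Cor. 3.8) the constant point at some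
  `Q₀ ∈ A(Ω)`;
* `AbelianVariety.exists_forall_prod_map_ptOfPlace_comapEmb_eq` — reducing at any place `w` of `M`
  (`PlaceReduction.redHom`, `red_const`, `red_embPt`): `∏_τ f(x_{τ^* w}) = Q₀`, where `x_v ∈ C(Ω)`
  is the point of the place `v` of `K(C)` and `τ^* w = τ⁻¹(𝒪_w)` (`PlaceOver.comapEmb`);
* `AbelianVariety.prod_map_ptOfPlace_comapEmb_eq_prod_zpow` — regrouped by the fibre count
  `#{τ ∣ τ^* w = v} = e(v ∣ w ∩ F₀)` (`PlaceOver.card_filter_comapEmb_eq`, Stichtenoth 3.7.1/3.7.2):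
  `Q₀ = ∏_{v ∣ w ∩ F₀} f(x_v)^{e(v ∣ w ∩ F₀)}`;
* `AbelianVariety.exists_forall_zpow_ord_eq_prod_zpow_ord` — hence, for EVERY place `P₀` of `F₀`
  and `y ∈ F₀`, `Q₀^{ord_{P₀} y} = ∏_{v ∣ P₀} f(x_v)^{ord_v y}` (no description of the places of
  `Ω(X)` is used);
* **`AbelianVariety.finprod_map_ptOfPlace_zpow_ord_algebraMap_eq_one`** — summing over the places of
  `F₀`: `∏ᶠ_v f(x_v)^{ord_v y} = Q₀^{deg (y)} = 1` for `0 ≠ y ∈ F₀` (`degree_principalDivisor_eq_zero`).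

Everything is proved; no definitions, no named facts (D-0026).

## References

* S. Lang, *Abelian Varieties*, Interscience 1959 / Springer 1983, II §2 Thm. 10 and its proof.
  [Lang1983AbelianVarieties]
* U. Görtz, T. Wedhorn, *Algebraic Geometry I*, 2nd ed. (2020), Thm. 14.72 (1). [GortzWedhorn2020]
* J. S. Milne, *Abelian Varieties*, in: Arithmetic Geometry (Cornell–Silverman, eds.), Springer
  1986, §3 Cor. 3.8. [Milne1986AbelianVarieties]
* H. Stichtenoth, *Algebraic Function Fields and Codes*, 2nd ed., GTM 254 (2009): Prop. 3.1.4,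
  Prop. 3.1.7 (b), Thm. 1.4.11, Thm. 3.7.1, Cor. 3.7.2. [Stichtenoth2009]
* R. Hartshorne, *Algebraic Geometry* (1977), II.4 Thm. 4.7, I.6 Lemma 6.5 (p. 41). [Hartshorne1977]
-/

noncomputable section

open CategoryTheory AlgebraicGeometry

universe u

namespace Literature.AlgebraicGeometry.Motives

open scoped MonObj

open Literature.NumberTheory.DiophantineGeometry
  Literature.NumberTheory.DiophantineGeometry.AlgFunctionField

/-! ### Reduction at a place is natural in the proper scheme -/

namespace PlaceReduction

section Naturality

variable {Ω : Type u} [Field Ω] {M : Type u} [Field M] [Algebra Ω M] (w : PlaceOver Ω M)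
  {Y Y' : SchemeOver Ω} [IsProper Y.hom] [IsProper Y'.hom]

/-- The `𝒪_w`-lift of `x ≫ g` is the `𝒪_w`-lift of `x` followed by `g` (uniqueness of lifts,
valuative criterion of separatedness). [cite: Hartshorne1977, II.4 Thm. 4.7] -/
theorem liftOver_comp (x : AlgPoints Y M) (g : Y ⟶ Y') :
    liftOver Y' w (x ≫ g) = liftOver Y w x ≫ g := by
  symm
  apply eq_liftOver
  rw [← Category.assoc, genOver_liftOver]

variable [IsAlgFunctionField Ω M] {w}

/-- **Reduction is natural**: `red (x ≫ g) = red x ≫ g` for a morphism `g : Y → Y'` of proper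
`Ω`-schemes. [cite: Hartshorne1977, II.4 Thm. 4.7] -/
theorem red_comp (hw : w.IsRational) (x : AlgPoints Y M) (g : Y ⟶ Y') :
    red Y' hw (x ≫ g) = red Y hw x ≫ g := by
  rw [red_def, red_def, liftOver_comp, Category.assoc]

/-- `red` commutes with `AlgPoints.map`. [cite: Hartshorne1977, II.4 Thm. 4.7] -/
theorem red_map (hw : w.IsRational) (g : Y ⟶ Y') (x : AlgPoints Y M) :
    red Y' hw (AlgPoints.map g x) = AlgPoints.map g (red Y hw x) :=
  red_comp hw x g

end Naturality

/-! ### Galois permutes the points attached to the embeddings of `K(C)` -/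

section Embeddings

variable {Ω : Type u} [Field Ω] {C : SchemeOver Ω} [IsIntegral C.left]
  {M : Type u} [Field M] [Algebra Ω M]

/-- **`σ • embPt τ = embPt (σ ∘ τ)`**: the automorphism `σ` of `M/Ω` (acting on `M`-points through
`Spec σ`, `AlgPoints.instMulActionAlgEquiv`) carries the point `Spec M → Spec K(C) → C` of the
`Ω`-embedding `τ : K(C) → M` to that of `σ ∘ τ` (contravariance of `Spec`; Lang's conjugates `Q_τ` of
the generic point). [cite: Lang1983AbelianVarieties, II §2 Thm. 10 (proof)] -/
theorem smul_embPt (σ : M ≃ₐ[Ω] M) (τ : C.left.functionField →ₐ[Ω] M) :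
    σ • embPt τ = embPt ((σ : M →ₐ[Ω] M).comp τ) := by
  rw [AlgPoints.smul_def, AlgPoints.specMap_eq_specOverMapOfAlgHom, embPt, embPt, ← Category.assoc,
    AbelianVariety.specOverMapOfAlgHom_comp]

end Embeddings

end PlaceReduction

/-! ### The conjugate product `∏_τ f(embPt τ)` is Galois invariant, hence constant -/

namespace AbelianVariety

open PlaceReduction

section RestrictScalars

variable {Ω : Type u} [Field Ω] {F₀ L M : Type u} [Field F₀] [Field L] [Field M]
  [Algebra Ω F₀] [Algebra Ω L] [Algebra Ω M] [Algebra F₀ L] [Algebra F₀ M]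
  [IsScalarTower Ω F₀ L] [IsScalarTower Ω F₀ M]

/-- The `Ω`-embedding underlying an `F₀`-embedding `τ : L → M`, composed with `σ ∈ Gal(M/F₀)`:
`(σ|_Ω) ∘ (τ|_Ω) = (σ ∘ τ)|_Ω`. [folklore] -/
private theorem restrictScalars_comp_restrictScalars (σ : M ≃ₐ[F₀] M) (τ : L →ₐ[F₀] M) :
    ((σ.restrictScalars Ω : M ≃ₐ[Ω] M) : M →ₐ[Ω] M).comp (τ.restrictScalars Ω) =
      ((σ : M →ₐ[F₀] M).comp τ).restrictScalars Ω :=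
  AlgHom.ext fun _ => rfl

end RestrictScalars

section ConjugateProduct

variable {Ω : Type u} [Field Ω] {C : SchemeOver Ω} [IsIntegral C.left]
  (A : AbelianVariety Ω) (f : C ⟶ A.X)
  {F₀ M : Type u} [Field F₀] [Field M] [Algebra Ω F₀] [Algebra Ω M]
  [Algebra F₀ C.left.functionField] [Algebra F₀ M]
  [IsScalarTower Ω F₀ C.left.functionField] [IsScalarTower Ω F₀ M]
  [FiniteDimensional F₀ C.left.functionField]

/-- **The conjugate product is Galois invariant**: for `σ ∈ Gal(M/F₀)`,
`σ • ∏_τ f(embPt τ) = ∏_τ f(embPt (σ ∘ τ)) = ∏_τ f(embPt τ)` (the action is by precomposition with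
`Spec σ`, a homomorphism on `A(M)`; `σ ∘ −` permutes the embeddings). This is Lang's «`T(u)` is
rational over `K(u)`». [cite: Lang1983AbelianVarieties, II §2 Thm. 10 (proof)] -/
theorem smul_prod_map_embPt (σ : M ≃ₐ[F₀] M) :
    (σ.restrictScalars Ω) • (∏ τ : C.left.functionField →ₐ[F₀] M,
        AlgPoints.map f (embPt (τ.restrictScalars Ω))) =
      ∏ τ : C.left.functionField →ₐ[F₀] M, AlgPoints.map f (embPt (τ.restrictScalars Ω)) := by
  rw [AlgPoints.smul_def]
  change precompHom (A := A) (AlgPoints.specMap (σ.restrictScalars Ω)) _ = _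
  rw [map_prod]
  simp only [precompHom_apply]
  -- `σ ∘ −` permutes the `F₀`-embeddings `K(C) → M`
  let E : (C.left.functionField →ₐ[F₀] M) ≃ (C.left.functionField →ₐ[F₀] M) :=
    { toFun := fun τ => (σ : M →ₐ[F₀] M).comp τ
      invFun := fun τ => (σ.symm : M →ₐ[F₀] M).comp τ
      left_inv := fun τ => by ext x; exact σ.symm_apply_apply (τ x)
      right_inv := fun τ => by ext x; exact σ.apply_symm_apply (τ x) }
  have hτ : ∀ τ : C.left.functionField →ₐ[F₀] M,
      AlgPoints.specMap (σ.restrictScalars Ω) ≫ AlgPoints.map f (embPt (τ.restrictScalars Ω)) =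
        AlgPoints.map f (embPt ((E τ).restrictScalars Ω)) := by
    intro τ
    rw [← AlgPoints.smul_def, ← AlgPoints.map_smul, smul_embPt, restrictScalars_comp_restrictScalars]
    rfl
  simp_rw [hτ]
  exact Fintype.prod_equiv E _ _ fun _ => rfl

variable [FiniteDimensional F₀ M] [IsGalois F₀ M]

/-- **The conjugate product is a constant point**: `∏_τ f(embPt τ) = const_M(Q₀)` for some
`Q₀ ∈ A(Ω)` — Galois descent to an `F₀`-point (Görtz–Wedhorn I Thm. 14.72 (1),
`AlgPoints.exists_eq_specOverMapOfAlgHom_of_forall_smul_eq`), then `A(F₀) = A(Ω)` for the rational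
function field `F₀ ≅ Frac Ω[X]` (Milne AV Cor. 3.8, `algPoints_const_of_algEquiv`). Lang: «`T(u)`
is rational over `K(u)` … it is constant». [cite: Lang1983AbelianVarieties, II §2 Thm. 10 (proof)]
[cite: GortzWedhorn2020, Thm. 14.72 (1)] [cite: Milne1986AbelianVarieties, §3 Cor. 3.8] -/
theorem exists_prod_map_embPt_eq_const
    (e : FractionRing (MvPolynomial (Fin 1) Ω) ≃ₐ[Ω] F₀) :
    ∃ Q₀ : AlgPoints A.X Ω,
      ∏ τ : C.left.functionField →ₐ[F₀] M, AlgPoints.map f (embPt (τ.restrictScalars Ω)) =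
        AlgPoints.specOverMapOfAlgHom (Algebra.ofId Ω M) ≫ Q₀ := by
  obtain ⟨w, hw⟩ := AlgPoints.exists_eq_specOverMapOfAlgHom_of_forall_smul_eq F₀ M
    (∏ τ : C.left.functionField →ₐ[F₀] M, AlgPoints.map f (embPt (τ.restrictScalars Ω)))
    (fun σ => smul_prod_map_embPt A f σ)
  obtain ⟨Q₀, hQ₀⟩ := A.algPoints_const_of_algEquiv e w
  refine ⟨Q₀, ?_⟩
  rw [hw, hQ₀, ← Category.assoc, specOverMapOfAlgHom_comp]
  congr 2
  exact Subsingleton.elim _ _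

end ConjugateProduct

/-! ### Specialisation: `∏_τ f(x_{τ^* w}) = Q₀` for every place `w` of `M` -/

section Specialisation

variable {Ω : Type u} [Field Ω] [IsAlgClosed Ω]
  {C : SchemeOver Ω} [IsIntegral C.left] [SmoothOfRelativeDimension 1 C.hom] [IsProper C.hom]
  (A : AbelianVariety Ω) (f : C ⟶ A.X)
  {F₀ M : Type u} [Field F₀] [Field M] [Algebra Ω F₀] [Algebra Ω M]
  [Algebra F₀ C.left.functionField] [Algebra C.left.functionField M] [Algebra F₀ M]
  [IsScalarTower Ω F₀ C.left.functionField] [IsScalarTower Ω C.left.functionField M]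
  [IsScalarTower Ω F₀ M] [IsScalarTower F₀ C.left.functionField M] [IsAlgFunctionField Ω M]
  [FiniteDimensional F₀ C.left.functionField] [FiniteDimensional C.left.functionField M]
  [FiniteDimensional F₀ M] [IsGalois F₀ M]

/-- **Specialisation of the conjugate product**: for every place `w` of `M/Ω`, reducing the
constant point `∏_τ f(embPt τ) = const_M(Q₀)` at `w` (a homomorphism `A(M) → A(Ω)`,
`PlaceReduction.redHom`; `red (embPt τ) = x_{τ^* w}`, `PlaceReduction.red_embPt`, Hartshorne I.6
Lemma 6.5) gives `∏_τ f(x_{τ^* w}) = Q₀`, where `x_v ∈ C(Ω)` is the point of the place `v` of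
`K(C)/Ω` and `τ^* w = τ⁻¹(𝒪_w)` (`PlaceOver.comapEmb`). Lang: «`T(u) → T(z)` … the `x'_i → x_i` be a
specialization». [cite: Lang1983AbelianVarieties, II §2 Thm. 10 (proof)] [cite: Hartshorne1977, I.6 Lemma 6.5 (p. 41)] -/
theorem exists_forall_prod_map_ptOfPlace_comapEmb_eq
    (e : FractionRing (MvPolynomial (Fin 1) Ω) ≃ₐ[Ω] F₀) :
    ∃ Q₀ : AlgPoints A.X Ω, ∀ w : PlaceOver Ω M,
      ∏ τ : C.left.functionField →ₐ[F₀] M,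
          AlgPoints.map f (ptOfPlace (PlaceOver.comapEmb (K := Ω) τ w)) = Q₀ := by
  obtain ⟨Q₀, hQ₀⟩ := exists_prod_map_embPt_eq_const A f (F₀ := F₀) (M := M) e
  refine ⟨Q₀, fun w => ?_⟩
  have hw : w.IsRational := PlaceOver.isRational_of_isAlgClosed w
  have h := congrArg (redHom A hw) hQ₀
  rw [map_prod, redHom_apply, red_const] at h
  rw [← h]
  refine Finset.prod_congr rfl fun τ _ => ?_
  rw [redHom_apply, red_map, red_embPt hw (τ.restrictScalars Ω) (PlaceOver.comapEmb (K := Ω) τ w)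
    fun g => PlaceOver.mem_comapEmb_iff (K := Ω) τ w g]

end Specialisation

/-! ### Regrouping by the fibre count, and the sum over the places of `F₀` -/

section Regrouping

variable {Ω : Type u} [Field Ω] [IsAlgClosed Ω]
  {C : SchemeOver Ω} [IsIntegral C.left] [SmoothOfRelativeDimension 1 C.hom] [IsProper C.hom]
  (A : AbelianVariety Ω) (f : C ⟶ A.X)
  {F₀ M : Type u} [Field F₀] [Field M] [Algebra Ω F₀] [Algebra Ω M]
  [Algebra F₀ C.left.functionField] [Algebra C.left.functionField M] [Algebra F₀ M]
  [IsScalarTower Ω F₀ C.left.functionField] [IsScalarTower Ω C.left.functionField M]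
  [IsScalarTower Ω F₀ M] [IsScalarTower F₀ C.left.functionField M]
  [IsAlgFunctionField Ω F₀] [IsAlgFunctionField Ω M]
  [FiniteDimensional F₀ C.left.functionField] [FiniteDimensional C.left.functionField M]
  [FiniteDimensional F₀ M] [IsGalois F₀ M]

/-- `∏ᵢ a ^ nᵢ = a ^ Σᵢ nᵢ` in a commutative group. [folklore] -/
private theorem prod_zpow_eq_zpow_sum {G : Type*} [CommGroup G] {β : Type*} (s : Finset β)
    (n : β → ℤ) (a : G) : ∏ i ∈ s, a ^ n i = a ^ ∑ i ∈ s, n i := by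
  classical
  induction s using Finset.induction_on with
  | empty => simp
  | insert i s hi ih => rw [Finset.prod_insert hi, Finset.sum_insert hi, ih, zpow_add]

/-- **Regrouping the conjugate product by places**: for a place `w` of `M` above the place
`P₀ = w ∩ F₀` of `F₀`, `∏_τ f(x_{τ^* w}) = ∏_{v ∣ P₀} f(x_v)^{e(v ∣ P₀)}`, the product over the
places `v` of `K(C)` above `P₀`, since exactly `e(v ∣ P₀)` embeddings `τ` induce `v` from `w`
(`PlaceOver.card_filter_comapEmb_eq`, Stichtenoth Thm. 3.7.1 / Cor. 3.7.2; `e(v ∣ P₀) = v(π_{P₀})`).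
[cite: Stichtenoth2009, Thm. 3.7.1 and Cor. 3.7.2] [cite: Lang1983AbelianVarieties, II §2 Thm. 10 (proof)] -/
theorem prod_map_ptOfPlace_comapEmb_eq_prod_zpow (w : PlaceOver Ω M) :
    ∏ τ : C.left.functionField →ₐ[F₀] M,
        AlgPoints.map f (ptOfPlace (PlaceOver.comapEmb (K := Ω) τ w)) =
      ∏ v ∈ ((w.restrict (K := Ω) (F := F₀)).finite_setOf_restrict_eq
          (F' := C.left.functionField)).toFinset,
        AlgPoints.map f (ptOfPlace v) ^
          v.ord (algebraMap F₀ C.left.functionField ((w.restrict (K := Ω) (F := F₀)).uniformizer : F₀)) := by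
  classical
  have hmem : ∀ τ : C.left.functionField →ₐ[F₀] M, PlaceOver.comapEmb (K := Ω) τ w ∈
      ((w.restrict (K := Ω) (F := F₀)).finite_setOf_restrict_eq
        (F' := C.left.functionField)).toFinset := by
    intro τ
    rw [PlaceOver.mem_toFinset_restrict_eq_iff]
    obtain ⟨σ, rfl⟩ := PlaceOver.exists_algEquiv_comp_eq (F₀ := F₀) (M := M) τ
    rw [PlaceOver.comapEmb_comp_eq, PlaceOver.restrict_restrict, PlaceOver.restrict_comapAlgEquiv]
  rw [← Finset.prod_fiberwise_of_maps_to' (s := Finset.univ)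
    (g := fun τ : C.left.functionField →ₐ[F₀] M => PlaceOver.comapEmb (K := Ω) τ w)
    (fun τ _ => hmem τ) (fun v => AlgPoints.map f (ptOfPlace (C := C) v))]
  refine Finset.prod_congr rfl fun v hv => ?_
  rw [Finset.prod_const, ← zpow_natCast]
  congr 1
  have hv' : v.restrict (K := Ω) (F := F₀) = w.restrict (K := Ω) (F := F₀) :=
    (PlaceOver.mem_toFinset_restrict_eq_iff _ v).1 hv
  have hcard := PlaceOver.card_filter_comapEmb_eq (K := Ω) (F₀ := F₀) (L := C.left.functionField)
    (M := M) (fun P => PlaceOver.isRational_of_isAlgClosed P)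
    (fun P => PlaceOver.isRational_of_isAlgClosed P) (fun P => PlaceOver.isRational_of_isAlgClosed P)
    w v hv'
  rw [← hcard]

include M in
/-- **The power identity**: for EVERY place `P₀` of `F₀` and every `y ∈ F₀`,
`Q₀ ^ {ord_{P₀} y} = ∏_{v ∣ P₀} f(x_v) ^ {ord_v y}` — the specialisation at a place `w` of `M` above
`P₀` (`exists_forall_prod_map_ptOfPlace_comapEmb_eq`, `PlaceOver.exists_restrict_eq'`), regrouped
(`prod_map_ptOfPlace_comapEmb_eq_prod_zpow`), and `ord_v y = e(v ∣ P₀) · ord_{P₀} y`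
(`PlaceOver.ord_algebraMap_eq_mul`, Stichtenoth Prop. 3.1.4). No description of the places of
`F₀ ≅ Ω(X)` is needed. [cite: Lang1983AbelianVarieties, II §2 Thm. 10 (proof)] [cite: Stichtenoth2009, Prop. 3.1.4 and Prop. 3.1.7(b)] -/
theorem exists_forall_zpow_ord_eq_prod_zpow_ord
    (e : FractionRing (MvPolynomial (Fin 1) Ω) ≃ₐ[Ω] F₀) :
    ∃ Q₀ : AlgPoints A.X Ω, ∀ (P₀ : PlaceOver Ω F₀) (y : F₀),
      Q₀ ^ P₀.ord y = ∏ v ∈ (P₀.finite_setOf_restrict_eq (F' := C.left.functionField)).toFinset,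
        AlgPoints.map f (ptOfPlace v) ^ v.ord (algebraMap F₀ C.left.functionField y) := by
  obtain ⟨Q₀, hQ₀⟩ := exists_forall_prod_map_ptOfPlace_comapEmb_eq A f (F₀ := F₀) (M := M) e
  refine ⟨Q₀, fun P₀ y => ?_⟩
  obtain ⟨w, hw⟩ := P₀.exists_restrict_eq' (F' := M)
  have h := hQ₀ w
  rw [prod_map_ptOfPlace_comapEmb_eq_prod_zpow A f w, hw] at h
  rw [← h, ← Finset.prod_zpow]
  refine Finset.prod_congr rfl fun v hv => ?_
  have hv' : v.restrict (K := Ω) (F := F₀) = P₀ := (PlaceOver.mem_toFinset_restrict_eq_iff P₀ v).1 hv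
  rw [← zpow_mul, PlaceOver.ord_algebraMap_eq_mul (K := Ω) v y, hv']

include M in
/-- **Abel's theorem along the tower**: for `0 ≠ y ∈ F₀`,
`∏ᶠ_v f(x_v) ^ {ord_v y} = 1`, the (finite) product over all places `v` of `K(C)/Ω`. Proof: group
the places `v` with `ord_v y ≠ 0` by the place `P₀ = v ∩ F₀` below them; each group contributes
`Q₀ ^ {ord_{P₀} y}` (`exists_forall_zpow_ord_eq_prod_zpow_ord`), and `Σ_{P₀} ord_{P₀} y = deg (y) = 0`
(Stichtenoth Thm. 1.4.11, `degree_principalDivisor_eq_zero`; all places of `F₀/Ω` are rational).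
[cite: Lang1983AbelianVarieties, II §2 Thm. 10] [cite: Stichtenoth2009, Thm. 1.4.11] -/
theorem finprod_map_ptOfPlace_zpow_ord_algebraMap_eq_one
    (e : FractionRing (MvPolynomial (Fin 1) Ω) ≃ₐ[Ω] F₀) {y : F₀} (hy : y ≠ 0) :
    ∏ᶠ v : PlaceOver Ω C.left.functionField,
        AlgPoints.map f (ptOfPlace v) ^ v.ord (algebraMap F₀ C.left.functionField y) = 1 := by
  classical
  obtain ⟨Q₀, hQ₀⟩ := exists_forall_zpow_ord_eq_prod_zpow_ord A f (F₀ := F₀) (M := M) e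
  have hyL : algebraMap F₀ C.left.functionField y ≠ 0 := (map_ne_zero _).2 hy
  set S := (finite_setOf_ord_ne_zero_of_ne_zero (K := Ω) hyL).toFinset with hS
  set S₀ := (finite_setOf_ord_ne_zero_of_ne_zero (K := Ω) hy).toFinset with hS₀
  -- the finite product over the support `S`
  rw [finprod_eq_prod_of_mulSupport_subset _ (s := S) (fun v hv => by
    rw [Finset.mem_coe, Set.Finite.mem_toFinset, Set.mem_setOf_eq]
    intro h0
    rw [Function.mem_mulSupport, h0, zpow_zero] at hv
    exact hv rfl)]
  -- fibrewise over the place of `F₀` below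
  have hmaps : ∀ v ∈ S, v.restrict (K := Ω) (F := F₀) ∈ S₀ := by
    intro v hv
    rw [Set.Finite.mem_toFinset, Set.mem_setOf_eq] at hv ⊢
    intro h0
    apply hv
    rw [PlaceOver.ord_algebraMap_eq_mul (K := Ω) v y, h0, mul_zero]
  rw [← Finset.prod_fiberwise_of_maps_to hmaps]
  have h2 : ∀ P₀ ∈ S₀, (∏ v ∈ S with v.restrict (K := Ω) (F := F₀) = P₀,
      AlgPoints.map f (ptOfPlace v) ^ v.ord (algebraMap F₀ C.left.functionField y)) =
        Q₀ ^ P₀.ord y := by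
    intro P₀ _
    rw [hQ₀ P₀ y]
    apply Finset.prod_subset
    · intro v hv
      rw [Finset.mem_filter] at hv
      exact (PlaceOver.mem_toFinset_restrict_eq_iff P₀ v).2 hv.2
    · intro v hvU hvS
      have hvP₀ := (PlaceOver.mem_toFinset_restrict_eq_iff P₀ v).1 hvU
      have hv0 : v.ord (algebraMap F₀ C.left.functionField y) = 0 := by
        by_contra h
        apply hvS
        rw [Finset.mem_filter, Set.Finite.mem_toFinset, Set.mem_setOf_eq]
        exact ⟨h, hvP₀⟩
      rw [hv0, zpow_zero]
  rw [Finset.prod_congr rfl h2, prod_zpow_eq_zpow_sum]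
  -- `Σ_{P₀} ord_{P₀} y = deg (y) = 0`
  have hsum : ∑ P₀ ∈ S₀, P₀.ord y = 0 := by
    have hdeg := degree_principalDivisor_eq_zero (K := Ω) hy
    rw [Divisor.degree_apply, Finsupp.sum] at hdeg
    have hsupp : (principalDivisor Ω y).support = S₀ := by
      ext P
      rw [Finsupp.mem_support_iff, hS₀, Set.Finite.mem_toFinset, Set.mem_setOf_eq,
        principalDivisor_apply_of_ne_zero (K := Ω) hy]
    rw [hsupp] at hdeg
    refine Eq.trans (Finset.sum_congr rfl fun P _ => ?_) hdeg
    have h1 : (P.degree : ℤ) = 1 := by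
      exact_mod_cast PlaceOver.isRational_of_isAlgClosed (K := Ω) P
    rw [principalDivisor_apply_of_ne_zero (K := Ω) hy, h1, mul_one]
  rw [hsum, zpow_zero]

end Regrouping

end AbelianVariety

end Literature.AlgebraicGeometry.Motives

end
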